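import Literature.NumberTheory.Automorphic.RegularRepresentationAuxModules
import Literature.NumberTheory.Automorphic.LevelControlExactSequences
import HarnessLib

/-!
# Finite-level control on the induced side: the four short exact sequences of `𝓕`'s

Topic `NumberTheory/Automorphic`; namespace `Literature.NumberTheory.Automorphic.LevelAction`;
definitions with bodies (`abbrev`s of short complexes and their Hecke endomorphisms) and
theorems, no named fact, no instance, no `sorry`.  Universe `0`.

We apply the exact functor `𝓕` (`inducedRep`/`inducedMap`, `shortExact_inducedMap`; `V` flat
over `R`) to the `Q`-module sequences of `RegularRepresentationAuxModules`,

* `unitSC`: `0 → 𝓕(R) → 𝓕(R[Q]) → 𝓕(C) → 0`,  `diffSC`: `0 → 𝓕(C) → 𝓕(⊕_t R[Q]) → 𝓕(C'') → 0`,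
* `augSC`: `0 → 𝓕(I_Q) → 𝓕(R[Q]) → 𝓕(R) → 0`,  `sumDiffSC`: `0 → 𝓕(K) → 𝓕(⊕_t R[Q]) → 𝓕(I_Q) → 0`,

equip the first two with the `U_p`-type endomorphisms `inducedHecke` of an adapted family
(`unitSCHecke`, `diffSCHecke`), and read off from the abstract long-exact-sequence lemmas of
`LevelControlExactSequences`:

* **`pow_inducedHeckeCohomology_apply_eq_zero_of_map_unit_eq_zero`** — if `U^m` kills
  `Hⁱ(𝓕 C)` then `U^m` kills `ker (Hʲ(𝓕 R) → Hʲ(𝓕 R[Q]))` (`i + 1 = j`);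
* **`pow_inducedHeckeCohomology_apply_mem_range_of_forall`** — if `U^n` kills `Hⁱ(𝓕 C'')` then
  `U^n ξ ∈ range (Hʲ(𝓕 R) → Hʲ(𝓕 R[Q]))` for every `ξ ∈ Hʲ(𝓕 R[Q])` fixed by all `𝓕(R_t)_*`;
* **`map_inducedMap_augMap_surjective`** — `Hʲ(𝓕 R[Q]) → Hʲ(𝓕 R)` (`= tr`) is onto if
  `Hʲ⁺¹(𝓕 I_Q) = 0`;
* **`exists_eq_sum_of_map_augMap_eq_zero`** — its kernel is `∑_t (𝓕(R_t) − 1)_* Hʲ(𝓕 R[Q])` if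
  moreover `Hʲ⁺¹(𝓕 K) = 0`.

This is the module-theoretic heart of [cite: KhareThorne2017, §6.3, Prop. 6.6] (there phrased via
`RΓ(X_{U'}, 𝓕) ⊗^𝐋_{𝒪[Δ̄]} -`), in the elementary form needed for the two extreme degrees.

## References

* C. Khare, J. A. Thorne, Amer. J. Math. 139 (2017), §6.3 (Lemma 6.5, Prop. 6.6, Lemma 6.9).
  [KhareThorne2017]
* H. Hida, Ann. Inst. Fourier 44 (1994), §2; Duke Math. J. 69 (1993), §5. [Hida1994AIF]
* K. S. Brown, *Cohomology of groups*, GTM 87, III.6. [Brown1982CohomologyGroups]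
-/

noncomputable section

open CategoryTheory groupCohomology
open scoped TensorProduct

namespace Literature.NumberTheory.Automorphic

namespace LevelAction

variable {R : Type} [CommRing R] {Γ 𝒢 : Type} [Group Γ] [Group 𝒢] (ι : Γ →* 𝒢)
  {Δ : Submonoid 𝒢} {V : Type} [AddCommGroup V] [Module R V] (τ : Δ →* Module.End R V)
  {U' : Subgroup 𝒢} (hU' : U'.toSubmonoid ≤ Δ) {Q : Type} [Group Q] (π : U' →* Q)

/-! ### Subtraction and `𝓕` -/

section Sub

variable {N N' : Type} [AddCommGroup N] [Module R N] [AddCommGroup N'] [Module R N']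
  {ρ : Representation R Q N} {ρ' : Representation R Q N'}

/-- Differences of equivariant maps are equivariant. [folklore] -/
theorem sub_equivariant' {φ ψ : N →ₗ[R] N'} (hφ : ∀ q : Q, φ ∘ₗ ρ q = ρ' q ∘ₗ φ)
    (hψ : ∀ q : Q, ψ ∘ₗ ρ q = ρ' q ∘ₗ ψ) (q : Q) : (φ - ψ) ∘ₗ ρ q = ρ' q ∘ₗ (φ - ψ) := by
  rw [LinearMap.sub_comp, LinearMap.comp_sub, hφ, hψ]

/-- **`𝓕(φ − ψ) = 𝓕(φ) − 𝓕(ψ)`.** [folklore] -/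
theorem inducedMap_sub (φ ψ : N →ₗ[R] N') (hφ : ∀ q : Q, φ ∘ₗ ρ q = ρ' q ∘ₗ φ)
    (hψ : ∀ q : Q, ψ ∘ₗ ρ q = ρ' q ∘ₗ ψ) :
    inducedMap ι τ hU' π ρ ρ' (φ - ψ) (sub_equivariant' hφ hψ) =
      inducedMap ι τ hU' π ρ ρ' φ hφ - inducedMap ι τ hU' π ρ ρ' ψ hψ := by
  refine Rep.hom_ext (Representation.IntertwiningMap.ext (LinearMap.ext fun f => Subtype.ext
    (funext fun g => ?_)))
  change LinearMap.rTensor V (φ - ψ) ((f : 𝒢 → N ⊗[R] V) g) =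
    LinearMap.rTensor V φ ((f : 𝒢 → N ⊗[R] V) g) - LinearMap.rTensor V ψ ((f : 𝒢 → N ⊗[R] V) g)
  rw [LinearMap.rTensor_sub, LinearMap.sub_apply]

/-- `𝓕(φ − id) = 𝓕(φ) − 𝟙`. [folklore] -/
theorem inducedMap_sub_id (φ : N →ₗ[R] N) (hφ : ∀ q : Q, φ ∘ₗ ρ q = ρ q ∘ₗ φ)
    (h : ∀ q : Q, (φ - LinearMap.id) ∘ₗ ρ q = ρ q ∘ₗ (φ - LinearMap.id)) :
    inducedMap ι τ hU' π ρ ρ (φ - LinearMap.id) h = inducedMap ι τ hU' π ρ ρ φ hφ - 𝟙 _ := by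
  rw [← inducedMap_id ι τ hU' π (ρ := ρ), ← inducedMap_sub]

end Sub

/-- `H^n(Γ, f − g) = H^n(Γ, f) − H^n(Γ, g)`. [folklore] -/
theorem map_id_sub {A B : Rep R Γ} (φ ψ : A ⟶ B) (n : ℕ) :
    map (MonoidHom.id Γ) (φ - ψ) n = map (MonoidHom.id Γ) φ n - map (MonoidHom.id Γ) ψ n := by
  rw [eq_sub_iff_add_eq, ← ArithmeticQuotient.map_id_add, sub_add_cancel]


/-! ### Induced maps on cohomology, with pinned source and target -/

section Maps

variable {N N' : Type} [AddCommGroup N] [Module R N] [AddCommGroup N'] [Module R N']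
  (ρ : Representation R Q N) (ρ' : Representation R Q N')

/-- **`Hʲ(𝓕 φ) : Hʲ(𝓕 N) → Hʲ(𝓕 N')`** (the functoriality map of group cohomology, with source and
target pinned so that unification never has to invert `Rep.res (MonoidHom.id Γ)`). [folklore] -/
abbrev inducedMapCohomology (φ : N →ₗ[R] N') (hφ : ∀ q : Q, φ ∘ₗ ρ q = ρ' q ∘ₗ φ) (j : ℕ) :
    inducedCohomology ι τ hU' π ρ j ⟶ inducedCohomology ι τ hU' π ρ' j :=
  map (MonoidHom.id Γ) (inducedMap ι τ hU' π ρ ρ' φ hφ) j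

/-- **`Hʲ(f)` for any morphism `f : 𝓕 N → 𝓕 N'`** with pinned source and target. [folklore] -/
abbrev inducedHomCohomology (f : inducedRep ι τ hU' π ρ ⟶ inducedRep ι τ hU' π ρ') (j : ℕ) :
    inducedCohomology ι τ hU' π ρ j ⟶ inducedCohomology ι τ hU' π ρ' j :=
  map (MonoidHom.id Γ) f j

end Maps

/-! ### The four short exact sequences -/

/-- **`0 → 𝓕(R) → 𝓕(R[Q]) → 𝓕(C) → 0`.** [cite: KhareThorne2017, §6.3] -/
abbrev unitSC : ShortComplex (Rep R Γ) :=
  ShortComplex.mk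
    (inducedMap ι τ hU' π (Representation.trivial R Q R) (piRegular R Q) (unitMap R Q)
      (unitMap_equivariant R Q))
    (inducedMap ι τ hU' π (piRegular R Q) (cokerUnitRep R Q) (LinearMap.range (unitMap R Q)).mkQ
      (mkQ_unit_equivariant R Q))
    (inducedMap_comp_eq_zero ι τ hU' π _ _ _ _
      (LinearMap.ext fun r => (exact_unitMap_mkQ R Q (unitMap R Q r)).2 ⟨r, rfl⟩))

/-- It is short exact. [cite: KhareThorne2017, §6.3 (Lemma 6.9)] -/
theorem unitSC_shortExact [Module.Flat R V] : (unitSC ι τ hU' π).ShortExact :=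
  shortExact_inducedMap ι τ hU' π _ _ _ _ (unitMap_injective R Q) (Submodule.mkQ_surjective _)
    (exact_unitMap_mkQ R Q)

/-- **`0 → 𝓕(C) → 𝓕(⊕_t R[Q]) → 𝓕(C'') → 0`.** [cite: KhareThorne2017, §6.3] -/
abbrev diffSC : ShortComplex (Rep R Γ) :=
  ShortComplex.mk
    (inducedMap ι τ hU' π (cokerUnitRep R Q) (piDiag (piRegular R Q) Q) (diffMap R Q)
      (diffMap_equivariant R Q))
    (inducedMap ι τ hU' π (piDiag (piRegular R Q) Q) (cokerDiffRep R Q)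
      (LinearMap.range (diffMap R Q)).mkQ (mkQ_diff_equivariant R Q))
    (inducedMap_comp_eq_zero ι τ hU' π _ _ _ _
      (LinearMap.ext fun c => (exact_diffMap_mkQ R Q (diffMap R Q c)).2 ⟨c, rfl⟩))

/-- It is short exact. [cite: KhareThorne2017, §6.3 (Lemma 6.9)] -/
theorem diffSC_shortExact [Module.Flat R V] : (diffSC ι τ hU' π).ShortExact :=
  shortExact_inducedMap ι τ hU' π _ _ _ _ (diffMap_injective R Q) (Submodule.mkQ_surjective _)
    (exact_diffMap_mkQ R Q)

/-- **`0 → 𝓕(I_Q) → 𝓕(R[Q]) → 𝓕(R) → 0`.** [cite: KhareThorne2017, §6.3] -/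
abbrev augSC [Fintype Q] : ShortComplex (Rep R Γ) :=
  ShortComplex.mk
    (inducedMap ι τ hU' π (augKerRep R Q) (piRegular R Q) (LinearMap.ker (augMap R Q)).subtype
      (subtype_aug_equivariant R Q))
    (inducedMap ι τ hU' π (piRegular R Q) (Representation.trivial R Q R) (augMap R Q)
      (augMap_equivariant R Q))
    (inducedMap_comp_eq_zero ι τ hU' π _ _ _ _
      (LinearMap.ext fun c => (exact_subtype_augMap R Q _).2 ⟨c, rfl⟩))

/-- It is short exact. [cite: KhareThorne2017, §6.3 (Lemma 6.9)] -/
theorem augSC_shortExact [Module.Flat R V] [Fintype Q] [DecidableEq Q] : (augSC ι τ hU' π).ShortExact :=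
  shortExact_inducedMap ι τ hU' π _ _ _ _ (Submodule.subtype_injective _) (augMap_surjective R Q)
    (exact_subtype_augMap R Q)

/-- **`0 → 𝓕(K) → 𝓕(⊕_t R[Q]) → 𝓕(I_Q) → 0`.** [cite: KhareThorne2017, §6.3] -/
abbrev sumDiffSC [Fintype Q] : ShortComplex (Rep R Γ) :=
  ShortComplex.mk
    (inducedMap ι τ hU' π (sumDiffKerRep R Q) (piDiag (piRegular R Q) Q)
      (LinearMap.ker (sumDiff R Q)).subtype (subtype_sumDiffKer_equivariant R Q))
    (inducedMap ι τ hU' π (piDiag (piRegular R Q) Q) (augKerRep R Q) (sumDiff R Q)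
      (sumDiff_equivariant R Q))
    (inducedMap_comp_eq_zero ι τ hU' π _ _ _ _
      (LinearMap.ext fun c => (exact_subtype_sumDiff R Q _).2 ⟨c, rfl⟩))

/-- It is short exact. [cite: KhareThorne2017, §6.3 (Lemma 6.9)] -/
theorem sumDiffSC_shortExact [Module.Flat R V] [Fintype Q] [DecidableEq Q] :
    (sumDiffSC ι τ hU' π).ShortExact :=
  shortExact_inducedMap ι τ hU' π _ _ _ _ (Submodule.subtype_injective _) (sumDiff_surjective R Q)
    (exact_subtype_sumDiff R Q)

/-! ### Their `U_p`-type endomorphisms -/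

variable {J : Type} [Fintype J] {a : J → 𝒢}

/-- The endomorphism of `unitSC` given by the `U_p`-type operators of an adapted family.
[cite: KhareThorne2017, §6.3, Lemma 6.5] -/
abbrev unitSCHecke (ha : IsAdaptedFamily Δ U' π a) : unitSC ι τ hU' π ⟶ unitSC ι τ hU' π where
  τ₁ := inducedHecke ι τ hU' π (Representation.trivial R Q R) ha
  τ₂ := inducedHecke ι τ hU' π (piRegular R Q) ha
  τ₃ := inducedHecke ι τ hU' π (cokerUnitRep R Q) ha
  comm₁₂ := inducedHecke_comp_inducedMap ι τ hU' π ha (unitMap R Q) (unitMap_equivariant R Q)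
  comm₂₃ := inducedHecke_comp_inducedMap ι τ hU' π ha (LinearMap.range (unitMap R Q)).mkQ
    (mkQ_unit_equivariant R Q)

/-- The endomorphism of `diffSC` given by the `U_p`-type operators of an adapted family.
[cite: KhareThorne2017, §6.3, Lemma 6.5] -/
abbrev diffSCHecke (ha : IsAdaptedFamily Δ U' π a) : diffSC ι τ hU' π ⟶ diffSC ι τ hU' π where
  τ₁ := inducedHecke ι τ hU' π (cokerUnitRep R Q) ha
  τ₂ := inducedHecke ι τ hU' π (piDiag (piRegular R Q) Q) ha
  τ₃ := inducedHecke ι τ hU' π (cokerDiffRep R Q) ha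
  comm₁₂ := inducedHecke_comp_inducedMap ι τ hU' π ha (diffMap R Q) (diffMap_equivariant R Q)
  comm₂₃ := inducedHecke_comp_inducedMap ι τ hU' π ha (LinearMap.range (diffMap R Q)).mkQ
    (mkQ_diff_equivariant R Q)

/-! ### The projections and inclusions of `𝓕(⊕_t R[Q])` -/

/-- `𝓕(proj_t) : 𝓕(⊕_t R[Q]) → 𝓕(R[Q])`. [folklore] -/
abbrev inducedProj (t : Q) :
    inducedRep ι τ hU' π (piDiag (piRegular R Q) Q) ⟶ inducedRep ι τ hU' π (piRegular R Q) :=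
  inducedMap ι τ hU' π _ _ (LinearMap.proj t) (proj_equivariant (piRegular R Q) Q t)

/-- `𝓕(incl_t) : 𝓕(R[Q]) → 𝓕(⊕_t R[Q])`. [folklore] -/
abbrev inducedSingle [DecidableEq Q] (t : Q) :
    inducedRep ι τ hU' π (piRegular R Q) ⟶ inducedRep ι τ hU' π (piDiag (piRegular R Q) Q) :=
  inducedMap ι τ hU' π _ _ (LinearMap.single R (fun _ : Q => Q → R) t)
    (single_equivariant (piRegular R Q) Q t)

/-- `𝓕(R_t) : 𝓕(R[Q]) → 𝓕(R[Q])` (the diamond operator of `t` on the induced side). [folklore] -/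
abbrev inducedShift (t : Q) :
    inducedRep ι τ hU' π (piRegular R Q) ⟶ inducedRep ι τ hU' π (piRegular R Q) :=
  inducedMap ι τ hU' π _ _ (rightShift R Q t) (rightShift_equivariant R Q t)

/-- **`∑_t 𝓕(proj_t) ≫ 𝓕(incl_t) = 𝟙`.** [folklore] -/
theorem sum_inducedProj_comp_inducedSingle [Fintype Q] [DecidableEq Q] :
    ∑ t : Q, inducedProj ι τ hU' π t ≫ inducedSingle ι τ hU' π t = 𝟙 _ := by
  have hφ : ∀ t : Q, ∀ q : Q,
      (LinearMap.single R (fun _ : Q => Q → R) t ∘ₗ LinearMap.proj t) ∘ₗ piDiag (piRegular R Q) Q q =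
        piDiag (piRegular R Q) Q q ∘ₗ (LinearMap.single R (fun _ : Q => Q → R) t ∘ₗ LinearMap.proj t) :=
    fun t => comp_equivariant' (proj_equivariant (piRegular R Q) Q t) (single_equivariant (piRegular R Q) Q t)
  have hs : ∀ q : Q, (∑ t ∈ Finset.univ, LinearMap.single R (fun _ : Q => Q → R) t ∘ₗ LinearMap.proj t) ∘ₗ
      piDiag (piRegular R Q) Q q = piDiag (piRegular R Q) Q q ∘ₗ
        ∑ t ∈ Finset.univ, LinearMap.single R (fun _ : Q => Q → R) t ∘ₗ LinearMap.proj t := fun q => by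
    rw [sum_single_comp_proj, LinearMap.id_comp, LinearMap.comp_id]
  calc ∑ t : Q, inducedProj ι τ hU' π t ≫ inducedSingle ι τ hU' π t
      = ∑ t ∈ Finset.univ, inducedMap ι τ hU' π _ _
          (LinearMap.single R (fun _ : Q => Q → R) t ∘ₗ LinearMap.proj t) (hφ t) :=
        Finset.sum_congr rfl fun t _ => (inducedMap_comp ι τ hU' π _ _ _ _).symm
    _ = inducedMap ι τ hU' π _ _ (∑ t ∈ Finset.univ,
          LinearMap.single R (fun _ : Q => Q → R) t ∘ₗ LinearMap.proj t) hs :=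
        (inducedMap_sum ι τ hU' π Finset.univ _ hφ hs).symm
    _ = inducedMap ι τ hU' π _ _ LinearMap.id (id_equivariant' (ρ := piDiag (piRegular R Q) Q)) :=
        inducedMap_congr ι τ hU' π _ _ (sum_single_comp_proj (R := R) (N := Q → R) Q)
    _ = 𝟙 _ := inducedMap_id ι τ hU' π

/-- **The projections are jointly injective on `Hʲ(𝓕(⊕_t R[Q]))`.** [folklore] -/
theorem eq_zero_of_forall_map_inducedProj_eq_zero [Fintype Q] [DecidableEq Q] (j : ℕ)
    (z : inducedCohomology ι τ hU' π (piDiag (piRegular R Q) Q) j)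
    (hz : ∀ t ∈ (Finset.univ : Finset Q), (inducedHomCohomology ι τ hU' π _ _ (inducedProj ι τ hU' π t) j).hom z = 0) :
    z = 0 :=
  LevelControl.eq_zero_of_forall_map_proj_eq_zero Finset.univ _ _
    (sum_inducedProj_comp_inducedSingle ι τ hU' π) j z hz

/-- **`Hʲ(𝓕(⊕_t R[Q]))` is generated by the images of the inclusions.** [folklore] -/
theorem exists_eq_sum_map_inducedSingle [Fintype Q] [DecidableEq Q] (j : ℕ)
    (z : inducedCohomology ι τ hU' π (piDiag (piRegular R Q) Q) j) :
    ∃ b : Q → inducedCohomology ι τ hU' π (piRegular R Q) j,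
      z = ∑ t ∈ (Finset.univ : Finset Q), (inducedHomCohomology ι τ hU' π _ _ (inducedSingle ι τ hU' π t) j).hom (b t) :=
  LevelControl.exists_eq_sum_map_incl Finset.univ _ _ (sum_inducedProj_comp_inducedSingle ι τ hU' π) j z

/-- `𝓕(R[Q] → C) ≫ 𝓕(m) ≫ 𝓕(proj_t) = 𝓕(R_t) − 𝟙`. [folklore] -/
theorem unitSC_g_comp_diffSC_f_comp_inducedProj (t : Q) :
    (unitSC ι τ hU' π).g ≫ (diffSC ι τ hU' π).f ≫ inducedProj ι τ hU' π t =
      inducedShift ι τ hU' π t - 𝟙 _ := by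
  rw [← inducedMap_comp, ← inducedMap_comp,
    ← inducedMap_sub_id ι τ hU' π (rightShift R Q t) (rightShift_equivariant R Q t)
      (rightShift_sub_id_equivariant R Q t)]
  exact inducedMap_congr ι τ hU' π _ _ (proj_comp_diffMap_comp_mkQ R Q t)

/-- `𝓕(incl_t) ≫ 𝓕(σ) ≫ 𝓕(I_Q ↪ R[Q]) = 𝓕(R_t) − 𝟙`. [folklore] -/
theorem inducedSingle_comp_sumDiffSC_g_comp_augSC_f [Fintype Q] [DecidableEq Q] (t : Q) :
    inducedSingle ι τ hU' π t ≫ (sumDiffSC ι τ hU' π).g ≫ (augSC ι τ hU' π).f =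
      inducedShift ι τ hU' π t - 𝟙 _ := by
  rw [← inducedMap_comp, ← inducedMap_comp,
    ← inducedMap_sub_id ι τ hU' π (rightShift R Q t) (rightShift_equivariant R Q t)
      (rightShift_sub_id_equivariant R Q t)]
  exact inducedMap_congr ι τ hU' π _ _ (subtype_comp_sumDiff_comp_single R Q t)

/-! ### Degree-one control on the induced side -/

/-- **Kernel of restriction**: if `U^m` kills `Hⁱ(𝓕 C)` then `U^m x = 0` for every
`x ∈ Hʲ(𝓕 R)` with `𝓕(η)_* x = 0` (`i + 1 = j`). [cite: KhareThorne2017, §6.3, Prop. 6.6]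
[cite: Hida1994AIF, §2] -/
theorem pow_inducedHeckeCohomology_apply_eq_zero_of_map_unit_eq_zero [Module.Flat R V]
    (ha : IsAdaptedFamily Δ U' π a) {i j : ℕ} (hij : i + 1 = j) {m : ℕ}
    (h₃ : ∀ y : inducedCohomology ι τ hU' π (cokerUnitRep R Q) i,
      (inducedHeckeCohomology ι τ hU' π ha i ^ m) y = 0)
    (x : inducedCohomology ι τ hU' π (Representation.trivial R Q R) j)
    (hx : (inducedMapCohomology ι τ hU' π _ _ (unitMap R Q) (unitMap_equivariant R Q) j).hom x = 0) :
    (inducedHeckeCohomology ι τ hU' π ha j ^ m) x = 0 := by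
  have h := LevelControl.pow_map_apply_eq_zero_of_map_f_eq_zero (unitSC_shortExact ι τ hU' π)
    (unitSCHecke ι τ hU' π ha) hij (m := m) h₃ x hx
  exact h

/-- **Invariant classes restrict, up to `U^n`**: if `U^n` kills `Hⁱ(𝓕 C'')` then for every
`ξ ∈ Hʲ(𝓕 R[Q])` fixed by all `𝓕(R_t)_*` (`t ∈ Q`), `U^n ξ ∈ range 𝓕(η)_*` (`i + 1 = j`).
[cite: KhareThorne2017, §6.3, Prop. 6.6] [cite: Hida1994AIF, §2] -/
theorem pow_inducedHeckeCohomology_apply_mem_range_of_forall [Module.Flat R V] [Fintype Q]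
    [DecidableEq Q] (ha : IsAdaptedFamily Δ U' π a) {i j : ℕ} (hij : i + 1 = j) {n : ℕ}
    (hC : ∀ c : inducedCohomology ι τ hU' π (cokerDiffRep R Q) i,
      (inducedHeckeCohomology ι τ hU' π ha i ^ n) c = 0)
    (ξ : inducedCohomology ι τ hU' π (piRegular R Q) j)
    (hξ : ∀ t : Q, (inducedHomCohomology ι τ hU' π _ _ (inducedShift ι τ hU' π t) j).hom ξ = ξ) :
    (inducedHeckeCohomology ι τ hU' π ha j ^ n) ξ ∈
      LinearMap.range (inducedMapCohomology ι τ hU' π _ _ (unitMap R Q) (unitMap_equivariant R Q) j).hom := by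
  have hξ' : ∀ t ∈ (Finset.univ : Finset Q),
      (inducedHomCohomology ι τ hU' π _ _ (inducedShift ι τ hU' π t - 𝟙 _) j).hom ξ = 0 := fun t _ => by
    rw [inducedHomCohomology, map_id_sub, groupCohomology.map_id, ModuleCat.hom_sub, LinearMap.sub_apply]
    change (inducedHomCohomology ι τ hU' π _ _ (inducedShift ι τ hU' π t) j).hom ξ - ξ = 0
    rw [hξ t, sub_self]
  have h := LevelControl.pow_map_apply_mem_range_of_forall (unitSC_shortExact ι τ hU' π)
    (diffSC ι τ hU' π).f (diffSC ι τ hU' π).g (diffSC ι τ hU' π).zero (diffSC_shortExact ι τ hU' π)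
    Finset.univ (fun t => inducedShift ι τ hU' π t - 𝟙 _) (inducedProj ι τ hU' π)
    (fun t _ => unitSC_g_comp_diffSC_f_comp_inducedProj ι τ hU' π t) hij
    (eq_zero_of_forall_map_inducedProj_eq_zero ι τ hU' π j) (unitSCHecke ι τ hU' π ha)
    (diffSCHecke ι τ hU' π ha) rfl (n := n) hC ξ hξ'
  exact h

/-! ### Top-degree control on the induced side -/

/-- **`tr_* = 𝓕(ε)_* : Hʲ(𝓕 R[Q]) → Hʲ(𝓕 R)` is surjective if `Hʲ⁺¹(𝓕 I_Q) = 0`.**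
[cite: KhareThorne2017, §6.3, Prop. 6.6] -/
theorem map_inducedMap_augMap_surjective [Module.Flat R V] [Fintype Q] [DecidableEq Q] (j : ℕ)
    [Subsingleton (inducedCohomology ι τ hU' π (augKerRep R Q) (j + 1))] :
    Function.Surjective
      (inducedMapCohomology ι τ hU' π _ _ (augMap R Q) (augMap_equivariant R Q) j).hom := by
  have h := LevelControl.map_g_surjective_of_subsingleton (augSC_shortExact ι τ hU' π) j
  exact h

/-- **`ker (tr_*) = ∑_t (𝓕(R_t) − 1)_* Hʲ(𝓕 R[Q])` if `Hʲ⁺¹(𝓕 I_Q) = 0` and `Hʲ⁺¹(𝓕 K) = 0`**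
(the coinvariants of `Hʲ(𝓕 R[Q])` map isomorphically onto `Hʲ(𝓕 R)` in the top degree).
[cite: KhareThorne2017, §6.3, Prop. 6.6] -/
theorem exists_eq_sum_of_map_augMap_eq_zero [Module.Flat R V] [Fintype Q] [DecidableEq Q] (j : ℕ)
    [Subsingleton (inducedCohomology ι τ hU' π (sumDiffKerRep R Q) (j + 1))]
    (x : inducedCohomology ι τ hU' π (piRegular R Q) j)
    (hx : (inducedMapCohomology ι τ hU' π _ _ (augMap R Q) (augMap_equivariant R Q) j).hom x = 0) :
    ∃ b : Q → inducedCohomology ι τ hU' π (piRegular R Q) j,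
      x = ∑ t ∈ (Finset.univ : Finset Q),
        (inducedHomCohomology ι τ hU' π _ _ (inducedShift ι τ hU' π t - 𝟙 _) j).hom (b t) := by
  have h := LevelControl.exists_eq_sum_map_of_map_g_eq_zero (augSC_shortExact ι τ hU' π)
    (sumDiffSC ι τ hU' π).f (sumDiffSC ι τ hU' π).g (sumDiffSC ι τ hU' π).zero
    (sumDiffSC_shortExact ι τ hU' π) Finset.univ (inducedSingle ι τ hU' π)
    (fun t => inducedShift ι τ hU' π t - 𝟙 _)
    (fun t _ => inducedSingle_comp_sumDiffSC_g_comp_augSC_f ι τ hU' π t) j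
    (exists_eq_sum_map_inducedSingle ι τ hU' π j) x hx
  exact h

end LevelAction

end Literature.NumberTheory.Automorphic
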